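import Summits.QuantumFields.YangMills.Theorems.UnitScaleTiltFluctuationComparisonRegPrRepAtHeightsWinRow
import Literature.MathematicalPhysics.QuantumFieldTheory.Balaban1983to89.T3AlphaInputsACTwoRunLevel
import Literature.MathematicalPhysics.QuantumFieldTheory.Balaban1983to89.T3Thresholds
import HarnessLib

/-!
# Crux `FluctuationComparisonRegPrL` (stmt-QuantumFields-19935), line v5h STUB 3′ `stub_alphaTwoRunOfLane` IN THE LANE'S DATA MODEL:
# the α-adapter `∃ D PT, RepAtHeights D ∧ PintDecompTrivT D PT ∧ TwoRunMinT D PT` FROM TWO NAMED LANE ROWS, thresholds discharged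
# (support file `--supports stmt-QuantumFields-19935`; nothing registered changes)

Fleet seat `ym-ust-19201-p2` (gen 4, socket pen).  WHAT THIS FILE PROVES.  With the interaction terms indexed by the coarse field (`TermFn`,
`T3AlphaInputsACTwoRunLevel` §4, p507948) the α-adapter of line v5h reads, for a constants record `𝔠` with [7]-constants `a₀ a₁`:
`OfV2At F 𝔠 a₀ a₁ → ∃ (D : AlphaDataT3 F γ) (PT : TermFn F), RepAtHeights D 𝔠.b₀ 𝔠.p₀ ε₀ ∧ PintDecompTrivT D PT ∧ TwoRunMinT D PT 𝔠.b₀ 𝔠.p₀ a`.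
THIS FILE derives it — in the REGISTERED quantifier shape of STUB 3′ (`∃ ε₁ ∃ a ∀ ε₀ ≤ ε₁ ∃ γ₁ ∀ F γ …`) — from exactly TWO rows about the lane's v2 package
`OfV2At.pkgAtV2` / datum `OfV2At.dataT3c` (both hypothesis shapes, never asserted here):
* row (A) `rowA`: ★alpha-1's v3 residual `PinnedStep.Fibre55WinAC` (p… `AlphaInputsT3ACv3Step`) AT THE TRIVIAL NEW HISTORY of every step `k < K` of every run,
  for SOME window family WHOSE WINDOW OF THE OLD TRIVIAL HISTORY COVERS the small-field factor `χB_k(triv′)` (R-g18-a, route owner RULING g22-№5: the row's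
  left weight is the windowed `wtP_k(proj h′)`; print's (40) windows qualify, `AlphaInputsT3AC.wtP_admWindowT3_triv_eq_one`) — [Balaban1985UV3] (55) p.269
  with `χ_{k+1}` on the right, `χ_k` on the left, pinned masses; consumed through `repAtHeights_dataT3c_of_fibre55Win` (p506937, R-g18-a edition);
* rows (B)∧(C) `rowBC`: for SOME polymer parameter `π` and SOME term function `PT`, the trivial-history (43) re-indexing `PintDecompTrivT (dataT3c … π) PT`
  (lane adapter over `Carriers.pintOfSeries`, M) and the folded two-run bundle `TwoRunMinT (dataT3c … π) PT 𝔠.b₀ 𝔠.p₀ a` at ONE exponent `a > 0` chosen before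
  the family ((44) at the trivial history + the geometric clauses over the lane's `tsys` domains + the cross-cut-off row `PolymerCauchyMinAtT` — located,
  UNPRINTED for non-abelian d = 3, [King1986] Props 3.8–3.9 being the abelian template);
with the adapter's thresholds DISCHARGED: `ε₁ := a₀`, and `γ₁(𝔠, ε₀)` from `T3Thresholds.exists_gamma_forall_θBal_le` so that `θBal(n) ≤ a₁`, `B₃·θBal(n) ≤ ε₀`,
`4·θBal(n) < ε₀` at every distance `n` (`exists_gamma_thresholds`).  So a re-cut STUB 3′ over `TermFn` is CLOSED MODULO {row (A), rows (B)∧(C)} by name,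
kernel-checked; the genuinely open mathematics is rows (B)∧(C)'s `PolymerCauchyMinAtT`.  [cite: Balaban1985UV3, Thm 2 p.272; King1986, Prop. 3.8-3.9 pp.664-665]

References: T. Bałaban, CMP 102 (1985) 255–275 [Balaban1985UV3] ((41) p.266, (43)–(47) pp.266–267, (55)–(58) pp.269–270, Thm 2 p.272); T. Bałaban, CMP 102 (1985)
277–309 [Balaban1985Variational] (Thm 1 p.279); C. King, CMP 102 (1986) 649–677 [King1986] (Props 3.8–3.9 pp.664–665).
-/

set_option autoImplicit false

noncomputable section

namespace Summit.QuantumFields.YangMills.Theorems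

open MeasureTheory Filter
open Literature.MathematicalPhysics.QuantumFieldTheory.Balaban1983to89
open Literature.MathematicalPhysics.QuantumFieldTheory.Balaban1983to89.T3ContinuumYM3Torus
open Literature.MathematicalPhysics.QuantumFieldTheory.Balaban1983to89.T3UnitScaleTilt (θBal)
open Literature.MathematicalPhysics.QuantumFieldTheory.Balaban1983to89.T3AlphaInputsAC
open Literature.MathematicalPhysics.QuantumFieldTheory.Balaban1983to89.T3AlphaInputsACTwoRunLevel
open Literature.MathematicalPhysics.QuantumFieldTheory.Balaban1985CMP102
open Literature.MathematicalPhysics.QuantumFieldTheory.Balaban1985CMP102.Setting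
open Summit.QuantumFields.Balaban3D.Carriers
open Summit.QuantumFields.Balaban3D.Proofs.Primitives
open Summit.QuantumFields.Balaban3D.Proofs.Bound55Masses (chiB)

/-! ## §1 The adapter's thresholds from a small coupling -/

/-- **THE α-ADAPTER'S THRESHOLDS HOLD AT EVERY DISTANCE ONCE THE COUPLING IS SMALL**: for a profile `b₀, p₀ > 0`, a [7]-constant `a₁ > 0`, a constant `B₃ ≥ 0`
and a radius `ε₀ > 0` there is `γ₁ ∈ (0, 1]` such that for every block size `L ≥ 1`, every `γ ∈ (0, γ₁]` and every distance `n`: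
`θBal L γ b₀ p₀ n ≤ a₁`, `B₃·θBal L γ b₀ p₀ n ≤ ε₀` and `4·θBal L γ b₀ p₀ n < ε₀` (`T3Thresholds.exists_gamma_forall_θBal_le` at `σ = min a₁ (ε₀/(B₃+5))`).
[cite: Balaban1985Variational, Thm 1 p.279] -/
theorem LogComparisonAlphaAdapter.exists_gamma_thresholds {b₀ p₀ a₁ B₃ ε₀ : ℝ}
    (hb : 0 < b₀) (hp : 0 < p₀) (ha₁ : 0 < a₁) (hB : 0 ≤ B₃) (hε : 0 < ε₀) :
    ∃ γ₁ : ℝ, 0 < γ₁ ∧ γ₁ ≤ 1 ∧ ∀ L : ℕ, 1 ≤ L → ∀ γ : ℝ, 0 < γ → γ ≤ γ₁ →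
      (∀ n : ℕ, θBal L γ b₀ p₀ n ≤ a₁) ∧ (∀ n : ℕ, B₃ * θBal L γ b₀ p₀ n ≤ ε₀) ∧ (∀ n : ℕ, 4 * θBal L γ b₀ p₀ n < ε₀) := by
  have hB5 : 0 < B₃ + 5 := by linarith
  have hσ : 0 < min a₁ (ε₀ / (B₃ + 5)) := lt_min ha₁ (div_pos hε hB5)
  obtain ⟨γ₁, hγ₁, hγ₁1, hθ⟩ := T3Thresholds.exists_gamma_forall_θBal_le hb hp hσ
  refine ⟨γ₁, hγ₁, hγ₁1, fun L hL γ hγ hγγ₁ => ?_⟩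
  have hθ' := hθ L hL γ hγ hγγ₁
  have hq : ε₀ / (B₃ + 5) * (B₃ + 5) = ε₀ := div_mul_cancel₀ ε₀ hB5.ne'
  refine ⟨fun n => (hθ' n).trans (min_le_left _ _), fun n => ?_, fun n => ?_⟩
  · have h1 : B₃ * θBal L γ b₀ p₀ n ≤ B₃ * (ε₀ / (B₃ + 5)) :=
      mul_le_mul_of_nonneg_left ((hθ' n).trans (min_le_right _ _)) hB
    have h2 : B₃ * (ε₀ / (B₃ + 5)) ≤ ε₀ := by
      have h3 : B₃ * (ε₀ / (B₃ + 5)) ≤ (B₃ + 5) * (ε₀ / (B₃ + 5)) :=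
        mul_le_mul_of_nonneg_right (by linarith) (div_pos hε hB5).le
      linarith [mul_comm (B₃ + 5) (ε₀ / (B₃ + 5))]
    exact h1.trans h2
  · have h1 : 4 * θBal L γ b₀ p₀ n ≤ 4 * (ε₀ / (B₃ + 5)) :=
      mul_le_mul_of_nonneg_left ((hθ' n).trans (min_le_right _ _)) (by norm_num)
    have h2 : 4 * (ε₀ / (B₃ + 5)) < ε₀ := by
      have h3 : 4 * (ε₀ / (B₃ + 5)) < (B₃ + 5) * (ε₀ / (B₃ + 5)) :=
        mul_lt_mul_of_pos_right (by linarith) (div_pos hε hB5)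
      linarith [mul_comm (B₃ + 5) (ε₀ / (B₃ + 5))]
    exact lt_of_le_of_lt h1 h2

/-! ## §2 Per family: the α-adapter's conclusion over `TermFn` from the two rows -/

section PerFamily

variable {F : T3Family} {𝔠 : AlphaConsts F.L (suGroupModel 2).N} {a₀ a₁ : ℝ}
  (h : AlphaInputsT3AC.OfV2At F 𝔠 a₀ a₁) (hc : 0 < a₀ ∧ 0 < a₁ ∧ 𝔠.B₃ * a₁ ≤ a₀) (γ : ℝ) (hγ : 0 < γ)
  (hγ1 : γ ≤ (min 𝔠.gamma0 1) ^ 2) (π : AlphaInputsT3AC.PolymerT3 F)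

/-- **PER FAMILY: STUB 3′'s CONCLUSION OVER `TermFn` AT THE LANE'S DATUM from row (A) (v3 residual at the trivial history, any window family whose window of
the old trivial history covers `χB_k(triv′)` — `hsupp`, R-g18-a), rows (B)∧(C) (`PintDecompTrivT ∧ TwoRunMinT` for the datum with polymer parameter `π` and a
term function `PT`) and the thresholds** — `D := OfV2At.dataT3c … π`. [cite: Balaban1985UV3, Thm 2 p.272; King1986, Prop. 3.8-3.9 pp.664-665] -/
theorem AlphaInputsT3AC.OfV2At.alphaTwoRunT_of_rows
    (win : (K k : ℕ) → Hist (F.P K) (k + 1) → Set (GaugeField (F.P K) (k + 1) (Matrix.specialUnitaryGroup (Fin 2) ℂ)))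
    (hwin : ∀ (K k : ℕ), k + 1 ≤ K →
      PinnedStep.Fibre55WinAC 𝔠.lane (h.pkgAtV2 hc γ hγ hγ1 K).X (h.pkgAtV2 hc γ hγ hγ1 K).𝔖 (win K) k (Hist.triv (F.P K) (k + 1)))
    (hsupp : ∀ (K k : ℕ), k + 1 ≤ K → ∀ U : GaugeField (F.P K) k (Matrix.specialUnitaryGroup (Fin 2) ℂ),
      chiB 𝔠.lane.carrier.M₁ (rcolOf (T3Scales F γ hγ (hγ1.trans (sq_min_one_le _ 𝔠.gamma0_pos)) K) 𝔠.lane.carrier)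
          (eps1Of (T3Scales F γ hγ (hγ1.trans (sq_min_one_le _ 𝔠.gamma0_pos)) K) 𝔠.lane.carrier) k (Hist.triv (F.P K) (k + 1)) U ≠ 0 →
        PinnedStep.wtP 𝔠.lane (h.pkgAtV2 hc γ hγ hγ1 K).X (win K) k (Hist.triv (F.P K) k) U = 1)
    {PT : TermFn F} {a : ℝ} (hB : PintDecompTrivT (h.dataT3c hc γ hγ hγ1 π) PT) (hC : TwoRunMinT (h.dataT3c hc γ hγ hγ1 π) PT 𝔠.b₀ 𝔠.p₀ a)
    (ε₀ : ℝ) (hε : 0 < ε₀) (hhi : ε₀ ≤ a₀)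
    (ha₁ : ∀ n, θBal F.L γ 𝔠.b₀ 𝔠.p₀ n ≤ a₁) (hlo : ∀ n, 𝔠.B₃ * θBal F.L γ 𝔠.b₀ 𝔠.p₀ n ≤ ε₀) (h4 : ∀ n, 4 * θBal F.L γ 𝔠.b₀ 𝔠.p₀ n < ε₀) :
    ∃ (D : AlphaDataT3 F γ) (PT' : TermFn F), RepAtHeights D 𝔠.b₀ 𝔠.p₀ ε₀ ∧ PintDecompTrivT D PT' ∧ TwoRunMinT D PT' 𝔠.b₀ 𝔠.p₀ a :=
  ⟨h.dataT3c hc γ hγ hγ1 π, PT, h.repAtHeights_dataT3c_of_fibre55Win hc γ hγ hγ1 π win hwin hsupp ε₀ hε hhi ha₁ hlo h4, hB, hC⟩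

end PerFamily

/-! ## §3 The registered quantifier shape: STUB 3′ over `TermFn` ⟸ row (A) ∧ rows (B)∧(C), thresholds discharged -/

/-- **STUB 3′ OVER `TermFn` IS CLOSED MODULO THE TWO LANE ROWS**: for a block size `L`, a constants record `𝔠 : AlphaConsts L 2` with [7]-constants `0 < a₀`, `0 < a₁`,
`B₃·a₁ ≤ a₀`: IF (row (A)) below some coupling `γA(𝔠)` every family of block size `L` satisfying the v2 rows carries, for some window family whose windows of the
old trivial histories cover the small-field factors `χB_k(triv′)` (R-g18-a), the v3 residual `Fibre55WinAC` at the trivial new history of every step of every run, AND (rows (B)∧(C)) for some exponent `a(𝔠) > 0`, below some coupling `γB(𝔠)`, every such family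
carries a polymer parameter and a term function with `PintDecompTrivT ∧ TwoRunMinT … 𝔠.b₀ 𝔠.p₀ a` for its datum, THEN the α-adapter's conclusion holds in STUB 3′'s
registered quantifier shape with `ε₁ := a₀` and `γ₁(𝔠, ε₀) := min(γA, γB, γ(thresholds), (min γ₀ 1)²)`.  (The casts `hF ▸ 𝔠` read the `L`-level record on a family
with `F.L = L`, as in the registered text.) [cite: Balaban1985UV3, Thm 2 p.272; King1986, Prop. 3.8-3.9 pp.664-665] -/
theorem LogComparisonAlphaAdapter.stub_alphaTwoRunOfLaneT_of_rows (L : ℕ)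
    (𝔠 : AlphaConsts L (suGroupModel 2).N) (a₀ a₁ : ℝ) (ha0 : 0 < a₀) (ha1 : 0 < a₁) (hw : 𝔠.B₃ * a₁ ≤ a₀)
    (rowA : ∃ γA : ℝ, 0 < γA ∧ ∀ (F : T3Family) (γ : ℝ) (hF : F.L = L) (hγ : 0 < γ), γ ≤ γA →
        ∀ (hγ1 : γ ≤ (min (hF ▸ 𝔠).gamma0 1) ^ 2) (hc : 0 < a₀ ∧ 0 < a₁ ∧ (hF ▸ 𝔠).B₃ * a₁ ≤ a₀)
          (h : AlphaInputsT3AC.OfV2At F (hF ▸ 𝔠) a₀ a₁),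
          ∃ win : (K k : ℕ) → Hist (F.P K) (k + 1) → Set (GaugeField (F.P K) (k + 1) (Matrix.specialUnitaryGroup (Fin 2) ℂ)),
            (∀ (K k : ℕ), k + 1 ≤ K →
              PinnedStep.Fibre55WinAC (hF ▸ 𝔠).lane (h.pkgAtV2 hc γ hγ hγ1 K).X (h.pkgAtV2 hc γ hγ hγ1 K).𝔖 (win K) k (Hist.triv (F.P K) (k + 1))) ∧
            (∀ (K k : ℕ), k + 1 ≤ K → ∀ U : GaugeField (F.P K) k (Matrix.specialUnitaryGroup (Fin 2) ℂ),
              chiB (hF ▸ 𝔠).lane.carrier.M₁ (rcolOf (T3Scales F γ hγ (hγ1.trans (sq_min_one_le _ (hF ▸ 𝔠).gamma0_pos)) K) (hF ▸ 𝔠).lane.carrier)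
                  (eps1Of (T3Scales F γ hγ (hγ1.trans (sq_min_one_le _ (hF ▸ 𝔠).gamma0_pos)) K) (hF ▸ 𝔠).lane.carrier) k
                  (Hist.triv (F.P K) (k + 1)) U ≠ 0 →
                PinnedStep.wtP (hF ▸ 𝔠).lane (h.pkgAtV2 hc γ hγ hγ1 K).X (win K) k (Hist.triv (F.P K) k) U = 1))
    (rowBC : ∃ a : ℝ, 0 < a ∧ ∃ γB : ℝ, 0 < γB ∧ ∀ (F : T3Family) (γ : ℝ) (hF : F.L = L) (hγ : 0 < γ), γ ≤ γB →
        ∀ (hγ1 : γ ≤ (min (hF ▸ 𝔠).gamma0 1) ^ 2) (hc : 0 < a₀ ∧ 0 < a₁ ∧ (hF ▸ 𝔠).B₃ * a₁ ≤ a₀)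
          (h : AlphaInputsT3AC.OfV2At F (hF ▸ 𝔠) a₀ a₁),
          ∃ (π : AlphaInputsT3AC.PolymerT3 F) (PT : TermFn F),
            PintDecompTrivT (h.dataT3c hc γ hγ hγ1 π) PT ∧ TwoRunMinT (h.dataT3c hc γ hγ hγ1 π) PT (hF ▸ 𝔠).b₀ (hF ▸ 𝔠).p₀ a) :
    ∃ ε₁ : ℝ, 0 < ε₁ ∧ ∃ a : ℝ, 0 < a ∧ ∀ (ε₀ : ℝ), 0 < ε₀ → ε₀ ≤ ε₁ →
      ∃ γ₁ : ℝ, 0 < γ₁ ∧ ∀ (F : T3Family) (γ : ℝ) (hF : F.L = L), 0 < γ → γ ≤ γ₁ →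
        AlphaInputsT3AC.OfV2At F (hF ▸ 𝔠) a₀ a₁ →
          ∃ (D : AlphaDataT3 F γ) (PT : TermFn F), RepAtHeights D 𝔠.b₀ 𝔠.p₀ ε₀ ∧ PintDecompTrivT D PT ∧ TwoRunMinT D PT 𝔠.b₀ 𝔠.p₀ a := by
  obtain ⟨γA, hγA, hA⟩ := rowA
  obtain ⟨a, ha, γB, hγB, hBC⟩ := rowBC
  refine ⟨a₀, ha0, a, ha, fun ε₀ hε hhi => ?_⟩
  obtain ⟨γT, hγT, -, hT⟩ := LogComparisonAlphaAdapter.exists_gamma_thresholds (B₃ := 𝔠.B₃) 𝔠.b₀_pos 𝔠.p₀_pos ha1 𝔠.B₃_pos.le hε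
  have hg0 : 0 < (min 𝔠.gamma0 1) ^ 2 := pow_pos (lt_min 𝔠.gamma0_pos one_pos) 2
  refine ⟨min (min γA γB) (min γT ((min 𝔠.gamma0 1) ^ 2)), lt_min (lt_min hγA hγB) (lt_min hγT hg0), fun F γ hF hγ hγ₁ hOf => ?_⟩
  subst hF
  have hγA' : γ ≤ γA := hγ₁.trans ((min_le_left _ _).trans (min_le_left _ _))
  have hγB' : γ ≤ γB := hγ₁.trans ((min_le_left _ _).trans (min_le_right _ _))
  have hγT' : γ ≤ γT := hγ₁.trans ((min_le_right _ _).trans (min_le_left _ _))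
  have hγ1 : γ ≤ (min 𝔠.gamma0 1) ^ 2 := hγ₁.trans ((min_le_right _ _).trans (min_le_right _ _))
  have hc : 0 < a₀ ∧ 0 < a₁ ∧ 𝔠.B₃ * a₁ ≤ a₀ := ⟨ha0, ha1, hw⟩
  obtain ⟨win, hwin, hsupp⟩ := hA F γ rfl hγ hγA' hγ1 hc hOf
  obtain ⟨π, PT, hB, hC⟩ := hBC F γ rfl hγ hγB' hγ1 hc hOf
  obtain ⟨hT1, hT2, hT3⟩ := hT F.L F.hL.2.le γ hγ hγT'
  exact hOf.alphaTwoRunT_of_rows hc γ hγ hγ1 π win hwin hsupp hB hC ε₀ hε hhi hT1 hT2 hT3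

end Summit.QuantumFields.YangMills.Theorems

end
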